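import Literature.Computability.Complexity.GraphCanonizationSchemeEquiv
import Literature.Computability.Complexity.GraphCanonizationFinalParts
import HarnessLib

/-!
# The canoniser as a stack machine (the recursion of Corneil–Goldberg unrolled)

The recursion `CGCanon.canon R G W c` (`GraphCanonizationScheme.lean`; [CorneilGoldberg1984],
[Laubner2011, §3.4]) as an ITERATED STEP FUNCTION on a stack of frames — the shape in which a
polynomial-time string program evaluates it on the padded input (`GraphCanonizationProgram*.lean`):

* `CGCanon.Frame k` — `indiv W c cur xs best` (an individualization node: the branching vertices
  `xs` still to do, the vertex `cur` whose child is running, the least candidate `best` so far),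
  `sect W c cur todo done` (a section node: parts to do, the part whose child is running, the
  finished parts with their orderings), `ret ord` (a finished child);
* `CGCanon.classify R G W c` — the frame a fresh state starts in (the three cases of `canon`);
  `CGCanon.step R G` — one transition; `CGCanon.run R G n` — `n` transitions;
* `pasteM_eq_paste` — pasting the finished parts in any order equals `CGCanon.paste` (a sorted list
  is determined by its elements when the key is injective, `eq_of_perm_of_pairwise`);
* **`CGCanon.run_classify`** — SIMULATION: from `classify R G W c :: stk` the machine reaches
  `ret (canon R G W c) :: stk` in exactly `steps R G W c` transitions, and
  **`steps_le`**: `steps + 2 ≤ 5 · cost` (`cost` the node count of `GraphCanonizationFinalParts.lean`);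
  `run_halt` — a lone `ret` is a fixed point, so any larger number of transitions gives the same.

## References

* D. G. Corneil, M. K. Goldberg, J. Algorithms 5 (1984) 345–362. [CorneilGoldberg1984]
* B. Laubner, PhD thesis, HU Berlin 2011, doi:10.18452/16335, §3.4. [Laubner2011]
-/

namespace Literature.Computability.Complexity

open Literature.Combinatorics.SimpleGraph Finset ColourRefinementScheme

open scoped Classical

noncomputable section

namespace CGCanon

variable {k : ℕ}

/-! ### Sorted lists with an injective key are determined by their elements -/

/-- Two permutations of each other, both sorted by a key which is injective on their elements,
are equal. [folklore] -/
theorem eq_of_perm_of_pairwise {α β : Type} [LinearOrder β] (key : α → β) :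
    ∀ {l₁ l₂ : List α}, l₁.Perm l₂ → l₁.Pairwise (fun a b => key a ≤ key b) → l₂.Pairwise (fun a b => key a ≤ key b) →
      (∀ a ∈ l₁, ∀ b ∈ l₁, key a = key b → a = b) → l₁ = l₂
  | [], l₂, hp, _, _, _ => (List.Perm.nil_eq hp)
  | a :: t₁, l₂, hp, h₁, h₂, hinj => by
    obtain ⟨b, t₂, rfl⟩ : ∃ b t₂, l₂ = b :: t₂ := by
      cases l₂ with
      | nil => exact absurd hp.length_eq (by simp)
      | cons b t₂ => exact ⟨b, t₂, rfl⟩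
    rw [List.pairwise_cons] at h₁ h₂
    have hab : a = b := by
      have hb : b ∈ a :: t₁ := hp.mem_iff.2 List.mem_cons_self
      have ha : a ∈ b :: t₂ := hp.mem_iff.1 List.mem_cons_self
      rcases List.mem_cons.1 hb with rfl | hb'
      · rfl
      rcases List.mem_cons.1 ha with rfl | ha'
      · rfl
      exact hinj a List.mem_cons_self b hb (le_antisymm (h₁.1 b hb') (h₂.1 a ha'))
    subst hab
    rw [eq_of_perm_of_pairwise key (List.Perm.cons_inv hp) h₁.2 h₂.2 fun x hx y hy => hinj x (List.mem_cons_of_mem _ hx) y (List.mem_cons_of_mem _ hy)]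

/-! ### Frames, classification, transitions -/

/-- The candidates of an individualization node. [folklore] -/
abbrev Cand (k : ℕ) : Type := Lex (Code × Lex (ℕ × List (Fin k)))

/-- **Frames** of the stack machine. [cite: Laubner2011, §3.4 (the recursion tree)] -/
inductive Frame (k : ℕ) : Type
  /-- individualization node: state, running vertex, vertices to do, least candidate so far -/
  | indiv : Finset (Fin k) → (Fin k → ℕ) → Option (Fin k) → List (Fin k) → Option (Cand k) → Frame k
  /-- section node: state, running part, parts to do, finished parts with their orderings -/
  | sect : Finset (Fin k) → (Fin k → ℕ) → Option (Finset (Fin k)) → List (Finset (Fin k)) → List (Finset (Fin k) × List (Fin k)) → Frame k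
  /-- a finished child, with its ordering -/
  | ret : List (Fin k) → Frame k

variable (R : Refiner k) (G : SimpleGraph (Fin k))

/-- The enumeration of the parts used by the machine (component of each vertex in increasing
order, duplicates removed — the order in which the list program finds them). [folklore] -/
def partsList (W : Finset (Fin k)) (c : Fin k → ℕ) : List (Finset (Fin k)) := ((W.sort (· ≤ ·)).map (comp G W c)).dedup

/-- **The starting frame of a state** (the three cases of `canon`). [cite: Laubner2011, §3.4 steps 1–3] -/
def classify (W : Finset (Fin k)) (c : Fin k → ℕ) : Frame k :=
  if W.card ≤ 1 then Frame.ret (W.sort (· ≤ ·))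
  else if IsConn G W c then
    (if (bigMinCell W c).Nonempty then Frame.indiv W c none ((bigMinCell W c).sort (· ≤ ·)) none
     else Frame.ret (W.sort (· ≤ ·)))
  else Frame.sect W c none (partsList G W c) []

/-- Keeping the least candidate. [folklore] -/
def bestOf (o : Option (Cand k)) (b : Cand k) : Option (Cand k) := some (o.elim b fun a => min a b)

/-- The key of a finished part. [folklore] -/
def pkey (c : Fin k → ℕ) (p : Finset (Fin k) × List (Fin k)) : Lex (Code × List ℕ) := toLex (code G c p.2, (p.1.sort (· ≤ ·)).map Fin.val)

/-- Pasting finished parts: sort by key, concatenate the orderings. [cite: Laubner2011, Thm. 3.4.3] -/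
def pasteM (c : Fin k → ℕ) (done : List (Finset (Fin k) × List (Fin k))) : List (Fin k) :=
  (done.insertionSort fun a b => pkey G c a ≤ pkey G c b).flatMap Prod.snd

/-- **One transition of the machine.** [cite: Laubner2011, §3.4] -/
def step : List (Frame k) → List (Frame k)
  | Frame.ret ord :: Frame.indiv W c (some x) xs best :: stk =>
      Frame.indiv W c none xs (bestOf best (toLex (code G c ord, toLex (x.val, ord)))) :: stk
  | Frame.ret ord :: Frame.sect W c (some K) todo done :: stk => Frame.sect W c none todo (done ++ [(K, ord)]) :: stk
  | Frame.indiv W c _ (x :: xs) best :: stk =>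
      classify G W (R.refine G W (individualize c x)) :: Frame.indiv W c (some x) xs best :: stk
  | Frame.indiv _ _ _ [] best :: stk => Frame.ret (best.elim [] fun b => (ofLex (ofLex b).2).2) :: stk
  | Frame.sect W c _ (K :: todo) done :: stk => classify G K c :: Frame.sect W c (some K) todo done :: stk
  | Frame.sect _ c _ [] done :: stk => Frame.ret (pasteM G c done) :: stk
  | cfg => cfg

/-- `n` transitions. [folklore] -/
def run (n : ℕ) (cfg : List (Frame k)) : List (Frame k) := (step R G)^[n] cfg

/-- **The number of transitions** spent on the state `(W, c)`. [folklore] -/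
def steps : Finset (Fin k) → (Fin k → ℕ) → ℕ
  | W, c =>
    if W.card ≤ 1 then 0
    else if hconn : IsConn G W c then
      if (bigMinCell W c).Nonempty then
        (∑ x ∈ (bigMinCell W c).attach,
          have := measure_lt_of_mem_bigMinCell R G W c x.2
          (steps W (R.refine G W (individualize c x.1)) + 2)) + 1
      else 0
    else (∑ K ∈ (parts G W c).attach,
        have := card_lt_of_mem_parts hconn K.2
        (steps K.1 c + 2)) + 1
termination_by W c => (W.card, W.card - (W.image c).card)
decreasing_by
  · exact Prod.Lex.right _ this
  · exact Prod.Lex.left _ _ this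

variable {R G}

/-! ### Running -/

/-- Runs compose. [folklore] -/
theorem run_add (m n : ℕ) (cfg : List (Frame k)) : run R G (m + n) cfg = run R G n (run R G m cfg) := by
  unfold run; rw [Nat.add_comm, Function.iterate_add_apply]

/-- A lone finished frame is a fixed point. [folklore] -/
theorem run_halt (n : ℕ) (ord : List (Fin k)) : run R G n [Frame.ret ord] = [Frame.ret ord] := by
  induction n with
  | zero => rfl
  | succ n ih => rw [run_add, ih]; rfl

/-! ### The parts enumeration and pasting -/

/-- `partsList` lists the parts, each once. [folklore] -/
theorem partsList_perm_toList (W : Finset (Fin k)) (c : Fin k → ℕ) : (partsList G W c).Perm (parts G W c).toList := by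
  apply List.perm_of_nodup_nodup_toFinset_eq (List.nodup_dedup _) (nodup_toList _)
  ext K
  simp [parts, mem_image]

/-- **Pasting in any order is `paste`**: if `done` lists `(K, ordOf K)` over the parts, each once,
then `pasteM G c done = paste G c (parts G W c) ordOf`. [folklore] -/
theorem pasteM_eq_paste {W : Finset (Fin k)} {c : Fin k → ℕ} {ordOf : Finset (Fin k) → List (Fin k)}
    {done : List (Finset (Fin k) × List (Fin k))} (h : done.Perm ((parts G W c).toList.map fun K => (K, ordOf K))) :
    pasteM G c done = paste G c (parts G W c) ordOf := by
  unfold pasteM paste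
  set L₁ := done.insertionSort fun a b => pkey G c a ≤ pkey G c b
  set L₂ := (parts G W c).toList.insertionSort fun K K' => partKey G c ordOf K ≤ partKey G c ordOf K'
  have hkey : ∀ K, pkey G c (K, ordOf K) = partKey G c ordOf K := fun K => rfl
  have hL : L₁ = L₂.map fun K => (K, ordOf K) := by
    refine eq_of_perm_of_pairwise (pkey G c) ?_ (List.pairwise_insertionSort _ _) ?_ ?_
    · exact ((List.perm_insertionSort _ _).trans h).trans ((List.perm_insertionSort _ _).symm.map _)
    · rw [List.pairwise_map]
      exact (List.pairwise_insertionSort _ _).imp fun {a b} (hab : partKey G c ordOf a ≤ partKey G c ordOf b) => hab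
    · intro a ha b hb hab
      have ha' := ((List.perm_insertionSort _ _).trans h).mem_iff.1 ha
      have hb' := ((List.perm_insertionSort _ _).trans h).mem_iff.1 hb
      obtain ⟨Ka, -, rfl⟩ := List.mem_map.1 ha'
      obtain ⟨Kb, -, rfl⟩ := List.mem_map.1 hb'
      have hsort : Ka.sort (· ≤ ·) = Kb.sort (· ≤ ·) :=
        List.map_injective_iff.2 Fin.val_injective (Prod.ext_iff.1 (toLex.injective hab)).2
      have : Ka = Kb := by
        ext x; rw [← mem_sort (· ≤ ·), hsort, mem_sort]
      rw [this]
  rw [hL, List.flatMap_map]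

/-! ### Least candidates -/

/-- Folding `bestOf` over a nonempty list gives its least element. [folklore] -/
theorem foldl_bestOf (l : List (Cand k)) (o : Option (Cand k)) :
    l.foldl bestOf o = (o.elim (l.foldl bestOf none) fun a => some (l.foldl (fun m b => min m b) a)) := by
  induction l generalizing o with
  | nil => cases o <;> rfl
  | cons b l ih =>
    rw [List.foldl_cons, ih]
    cases o with
    | none => simp only [bestOf, Option.elim]; rw [List.foldl_cons, ih]; rfl
    | some a => rfl

/-- The minimum of a nonempty list is the `min'` of its elements. [folklore] -/
theorem foldl_min_eq_min' (l : List (Cand k)) (a : Cand k) :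
    l.foldl (fun m b => min m b) a = (insert a l.toFinset).min' (insert_nonempty _ _) := by
  induction l generalizing a with
  | nil => simp
  | cons b l ih =>
    rw [List.foldl_cons, ih]
    apply le_antisymm
    · refine Finset.le_min' _ _ _ fun x hx => ?_
      simp only [List.toFinset_cons, mem_insert, List.mem_toFinset] at hx
      rcases hx with rfl | rfl | hx
      · exact (min'_le _ _ (mem_insert_self _ _)).trans (min_le_left _ _)
      · exact (min'_le _ _ (mem_insert_self _ _)).trans (min_le_right _ _)
      · exact min'_le _ _ (mem_insert_of_mem (List.mem_toFinset.2 hx))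
    · refine Finset.le_min' _ _ _ fun x hx => ?_
      simp only [mem_insert, List.mem_toFinset] at hx
      rcases hx with rfl | hx
      · rcases min_choice a b with h | h <;> rw [h]
        · exact min'_le _ _ (by simp)
        · exact min'_le _ _ (by simp)
      · exact min'_le _ _ (by simp [hx])

/-- Folding `bestOf ∘ f` from `none` over a nonempty list gives the `min'` of the images. [folklore] -/
theorem foldl_bestOf_map {α : Type} (f : α → Cand k) {xs : List α} (hxs : xs ≠ []) :
    ∃ h, xs.foldl (fun o x => bestOf o (f x)) none = some ((xs.map f).toFinset.min' h) := by
  obtain ⟨x, xs', rfl⟩ : ∃ x xs', xs = x :: xs' := by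
    cases xs with
    | nil => exact absurd rfl hxs
    | cons x xs' => exact ⟨x, xs', rfl⟩
  have aux : ∀ (l : List α) (a : Cand k), l.foldl (fun o y => bestOf o (f y)) (some a) = some ((l.map f).foldl (fun m b => min m b) a) := by
    intro l
    induction l with
    | nil => intro a; rfl
    | cons y l ih => intro a; rw [List.foldl_cons, List.map_cons, List.foldl_cons]; exact ih (min a (f y))
  have hne : ((x :: xs').map f).toFinset.Nonempty := ⟨f x, by simp⟩
  refine ⟨hne, ?_⟩
  rw [List.foldl_cons, show bestOf none (f x) = some (f x) from rfl, aux, foldl_min_eq_min']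
  congr 1
  simp

/-! ### Unfolding the transition counts -/

variable {W : Finset (Fin k)} {c : Fin k → ℕ}

/-- Trivial states cost nothing. [folklore] -/
theorem steps_of_card_le_one (h : W.card ≤ 1) : steps R G W c = 0 := by rw [steps]; simp [h]

/-- Individualization nodes. [folklore] -/
theorem steps_of_isConn (hW : ¬ W.card ≤ 1) (h : IsConn G W c) (hA : (bigMinCell W c).Nonempty) :
    steps R G W c = (∑ x ∈ (bigMinCell W c).attach, (steps R G W (R.refine G W (individualize c x.1)) + 2)) + 1 := by
  rw [steps]; simp [hW, h, hA]

/-- Degenerate connected states. [folklore] -/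
theorem steps_of_isConn_of_not_nonempty (hW : ¬ W.card ≤ 1) (h : IsConn G W c) (hA : ¬ (bigMinCell W c).Nonempty) :
    steps R G W c = 0 := by rw [steps]; simp [hW, h, hA]

/-- Section nodes. [folklore] -/
theorem steps_of_not_isConn (hW : ¬ W.card ≤ 1) (h : ¬ IsConn G W c) :
    steps R G W c = (∑ K ∈ (parts G W c).attach, (steps R G K.1 c + 2)) + 1 := by
  rw [steps]; simp [hW, h]

/-- A list sum over a duplicate-free enumeration of a finset is the finset sum. [folklore] -/
theorem sum_map_eq_sum_attach {α : Type} {s : Finset α} {l : List α} (hl : l.Perm s.toList) (f : α → ℕ) :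
    (l.map f).sum = ∑ a ∈ s.attach, f a.1 := by
  rw [(hl.map f).sum_eq, sum_attach s f, sum_map_toList]

/-! ### Simulation -/

/-- One transition, unfolded with `run`. [folklore] -/
theorem run_succ (n : ℕ) (cfg : List (Frame k)) : run R G (n + 1) cfg = run R G n (step R G cfg) := by
  unfold run; rw [Function.iterate_succ_apply]

/-- **The machine simulates the canoniser**: from the starting frame of a state on top of any
stack, after exactly `steps R G W c` transitions the top frame is `ret (canon R G W c)` and the
rest of the stack is untouched. [cite: Laubner2011, §3.4 (the run of the recursion)] -/
theorem run_classify (R : Refiner k) (G : SimpleGraph (Fin k)) (W : Finset (Fin k)) (c : Fin k → ℕ) (stk : List (Frame k)) :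
    run R G (steps R G W c) (classify G W c :: stk) = Frame.ret (canon R G W c) :: stk := by
  suffices H : ∀ (n m : ℕ) (W : Finset (Fin k)) (c : Fin k → ℕ), W.card = n → W.card - (W.image c).card = m →
      ∀ stk, run R G (steps R G W c) (classify G W c :: stk) = Frame.ret (canon R G W c) :: stk from H _ _ W c rfl rfl stk
  intro n
  induction n using Nat.strong_induction_on with
  | _ n ihn =>
  intro m
  induction m using Nat.strong_induction_on with
  | _ m ihm =>
  intro W c hn hm stk
  by_cases hW : W.card ≤ 1
  · rw [steps_of_card_le_one hW, canon_of_card_le_one hW, classify, if_pos hW]; rfl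
  by_cases hconn : IsConn G W c
  · by_cases hA : (bigMinCell W c).Nonempty
    · -- individualization node: process the branching vertices one by one
      rw [steps_of_isConn hW hconn hA, canon_of_isConn hW hconn hA, classify, if_neg hW, if_pos hconn, if_pos hA]
      have inner : ∀ (xs : List (Fin k)), (∀ x ∈ xs, x ∈ bigMinCell W c) → ∀ (cur : Option (Fin k)) (best : Option (Cand k)),
          run R G ((xs.map fun x => steps R G W (R.refine G W (individualize c x)) + 2).sum) (Frame.indiv W c cur xs best :: stk) =
            Frame.indiv W c (if xs = [] then cur else none) [] (xs.foldl (fun o x => bestOf o (cand R G W c x)) best) :: stk := by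
        intro xs
        induction xs with
        | nil => intro _ cur best; rfl
        | cons x xs ih =>
          intro hxs cur best
          have hx : x ∈ bigMinCell W c := hxs x List.mem_cons_self
          rw [List.map_cons, List.sum_cons, show steps R G W (R.refine G W (individualize c x)) + 2 + (xs.map _).sum =
            ((1 + steps R G W (R.refine G W (individualize c x))) + 1) + (xs.map fun x => steps R G W (R.refine G W (individualize c x)) + 2).sum by ring,
            run_add, run_add, run_add]
          have h1 : run R G 1 (Frame.indiv W c cur (x :: xs) best :: stk) =
              classify G W (R.refine G W (individualize c x)) :: Frame.indiv W c (some x) xs best :: stk := by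
            rw [run_succ]; cases cur <;> rfl
          rw [h1, ihm _ (hm ▸ measure_lt_of_mem_bigMinCell R G W c hx) W _ hn rfl, run_succ]
          change run R G _ (Frame.indiv W c none xs (bestOf best (cand R G W c x)) :: stk) = _
          rw [ih (fun y hy => hxs y (List.mem_cons_of_mem _ hy))]
          simp
      rw [← sum_map_eq_sum_attach (sort_perm_toList (s := bigMinCell W c) (r := (· ≤ ·))) fun x => steps R G W (R.refine G W (individualize c x)) + 2,
        run_add, inner _ (fun x hx => by simpa using hx) none none, run_succ]
      simp only [ite_self]
      have hne : (bigMinCell W c).sort (· ≤ ·) ≠ [] := fun h => by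
        obtain ⟨x, hx⟩ := hA
        have : x ∈ (bigMinCell W c).sort (· ≤ ·) := by simpa using hx
        rw [h] at this
        exact List.not_mem_nil this
      obtain ⟨h, hfold⟩ := foldl_bestOf_map (cand R G W c) hne
      rw [hfold]
      change [Frame.ret (ofLex (ofLex (((bigMinCell W c).sort (· ≤ ·)).map (cand R G W c) |>.toFinset.min' h)).2).2] ++ stk = _
      have hS : (((bigMinCell W c).sort (· ≤ ·)).map (cand R G W c)).toFinset = (bigMinCell W c).attach.image fun x => cand R G W c x.1 := by
        ext γ
        simp only [List.mem_toFinset, List.mem_map, mem_sort, mem_image, mem_attach, true_and, Subtype.exists]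
        exact ⟨fun ⟨x, hx, h⟩ => ⟨x, hx, h⟩, fun ⟨x, hx, h⟩ => ⟨x, hx, h⟩⟩
      simp only [List.singleton_append, List.cons.injEq, and_true, Frame.ret.injEq]
      have hmin : ((((bigMinCell W c).sort (· ≤ ·)).map (cand R G W c)).toFinset.min' h) =
          ((bigMinCell W c).attach.image fun x => cand R G W c x.1).min' ((attach_nonempty_iff.2 hA).image _) := by
        congr 1
      rw [hmin]
    · rw [steps_of_isConn_of_not_nonempty hW hconn hA, canon_of_isConn_of_not_nonempty hW hconn hA, classify, if_neg hW,
        if_pos hconn, if_neg hA]; rfl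
  · -- section node: process the parts one by one
    rw [steps_of_not_isConn hW hconn, canon_of_not_isConn hW hconn, classify, if_neg hW, if_neg hconn]
    have inner : ∀ (todo : List (Finset (Fin k))), (∀ K ∈ todo, K ∈ parts G W c) →
        ∀ (cur : Option (Finset (Fin k))) (done : List (Finset (Fin k) × List (Fin k))),
        run R G ((todo.map fun K => steps R G K c + 2).sum) (Frame.sect W c cur todo done :: stk) =
          Frame.sect W c (if todo = [] then cur else none) [] (done ++ todo.map fun K => (K, canon R G K c)) :: stk := by
      intro todo
      induction todo with
      | nil => intro _ cur done; simp [run]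
      | cons K todo ih =>
        intro htodo cur done
        have hK : K ∈ parts G W c := htodo K List.mem_cons_self
        rw [List.map_cons, List.sum_cons, show steps R G K c + 2 + (todo.map _).sum =
          ((1 + steps R G K c) + 1) + (todo.map fun K => steps R G K c + 2).sum by ring, run_add, run_add, run_add]
        have h1 : run R G 1 (Frame.sect W c cur (K :: todo) done :: stk) = classify G K c :: Frame.sect W c (some K) todo done :: stk := by
          rw [run_succ]; cases cur <;> rfl
        rw [h1, ihn K.card (hn ▸ card_lt_of_mem_parts hconn hK) _ K c rfl rfl, run_succ]
        change run R G _ (Frame.sect W c none todo (done ++ [(K, canon R G K c)]) :: stk) = _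
        rw [ih (fun K' hK' => htodo K' (List.mem_cons_of_mem _ hK'))]
        simp
    rw [← sum_map_eq_sum_attach (partsList_perm_toList (G := G) W c) fun K => steps R G K c + 2, run_add,
      inner _ (fun K hK => mem_toList.1 ((partsList_perm_toList W c).mem_iff.1 hK)) none [], run_succ]
    simp only [ite_self, List.nil_append]
    change [Frame.ret (pasteM G c ((partsList G W c).map fun K => (K, canon R G K c)))] ++ stk = _
    rw [List.singleton_append, pasteM_eq_paste]
    refine (List.Perm.map _ (partsList_perm_toList W c)).trans (List.Perm.of_eq (List.map_congr_left fun K hK => ?_))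
    rw [if_pos (mem_toList.1 hK)]

/-! ### The transition count against the node count -/

/-- **`steps + 2 ≤ 5 · cost`**: each node of the recursion tree costs at most five transitions. [folklore] -/
theorem steps_le (R : Refiner k) (G : SimpleGraph (Fin k)) (W : Finset (Fin k)) (c : Fin k → ℕ) :
    steps R G W c + 2 ≤ 5 * cost R G W c := by
  suffices H : ∀ (n m : ℕ) (W : Finset (Fin k)) (c : Fin k → ℕ), W.card = n → W.card - (W.image c).card = m →
      steps R G W c + 2 ≤ 5 * cost R G W c from H _ _ W c rfl rfl
  intro n
  induction n using Nat.strong_induction_on with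
  | _ n ihn =>
  intro m
  induction m using Nat.strong_induction_on with
  | _ m ihm =>
  intro W c hn hm
  by_cases hW : W.card ≤ 1
  · rw [steps_of_card_le_one hW, cost_of_card_le_one hW]; omega
  by_cases hconn : IsConn G W c
  · by_cases hA : (bigMinCell W c).Nonempty
    · rw [steps_of_isConn hW hconn hA, cost_of_isConn hW hconn hA, Nat.mul_add, mul_sum]
      have := sum_le_sum (s := (bigMinCell W c).attach) fun x _ =>
        ihm _ (hm ▸ measure_lt_of_mem_bigMinCell R G W c x.2) W (R.refine G W (individualize c x.1)) hn rfl
      omega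
    · rw [steps_of_isConn_of_not_nonempty hW hconn hA, cost_of_isConn_of_not_nonempty hW hconn hA]; omega
  · rw [steps_of_not_isConn hW hconn, cost_of_not_isConn hW hconn, Nat.mul_add, mul_sum]
    have := sum_le_sum (s := (parts G W c).attach) fun K _ => ihn K.1.card (hn ▸ card_lt_of_mem_parts hconn K.2) _ K.1 c rfl rfl
    omega

/-- Hence any `n ≥ 5 · cost` transitions from the starting frame of a state alone end in
`[ret (canon R G W c)]`. [folklore] -/
theorem run_classify_of_le (R : Refiner k) (G : SimpleGraph (Fin k)) (W : Finset (Fin k)) (c : Fin k → ℕ) {n : ℕ}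
    (hn : 5 * cost R G W c ≤ n) : run R G n [classify G W c] = [Frame.ret (canon R G W c)] := by
  obtain ⟨d, rfl⟩ := Nat.exists_eq_add_of_le ((steps_le R G W c).trans hn |> le_trans (Nat.le_add_right _ _))
  rw [run_add, run_classify, run_halt]

end CGCanon

end

end Literature.Computability.Complexity
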